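import Summits.CriticalPhenomena.PercolationContinuityZ3.Theorems.PercNearOneGluingNoHeavyLowerTailAPLVwEasy
import HarnessLib

/-!
# `NoHeavyLowerTail` (stmt-CriticalPhenomena-4575) — the LAYER-CAKE route to (V): the telescoping lemma
# "(LC) ⟹ (V)", the tree induction step for (LC-F), and the two-point mixture recursion for the third cumulant

Support file (prover prim-ineq-gen-8 gen 46; `--supports stmt-CriticalPhenomena-4575`; memo
run/shared/lean/prim/prim-ineq-gen-8/FINDING-gen46b-LAYERCAKE.md §§1–3).  Pure real algebra: no definitions, no named facts, no sorries.

SETTING (memo §2 of FINDING-gen46-DVHARD.md).  Explore the cluster `K = C_a` of the apex edge by edge; a state `s` is reached with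
probability `w_s` and queries an edge of weight `p_s` (`q_s = 1 − p_s`) into a new vertex `y_s`; `ν_s = w_s p_s q_s`; the PIECE `D_s` is the
load that the edge attaches if open; `a_s = E[D_s | s]`, `b_s = E[D_s² | s]`, `m̂_s = b_s / a_s` (size-biased piece load),
`c_s = Σ_z ℓ_z φ_s(z)²`.  Exactly: `Var L = Σ_s ν_s a_s²`, `|Cov(L,R)| = Σ_s ν_s a_s b_s`, `E L = Σ_s w_s p_s ℓ_{y_s}`,
`Σ_z ℓ_z p_z(1−p_z) = Σ_s ν_s c_s`.  The LAYER-CAKE inequality (LC) is: for every threshold `m`,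
`Σ_{s : m̂_s ≤ m} ν_s a_s² ≤ m · E L`; its sharp form (LC-F) has `Σ_z ℓ_z p_z (1 − p_z)` in place of `E L`.

THIS FILE proves [this work]:
* `layerCake_sq_le` — **(LC) ⟹ (V)**: for reals `x_i ≥ 0`, `m_i`, `E` on a finite index set with `Σ_{j : m_j ≤ m_i} x_j ≤ m_i E` for every `i`,
  `(Σ_i x_i)² ≤ 2 E Σ_i x_i m_i`.  (Read `x_s = ν_s a_s²`, `m_s = m̂_s`, so `Σ x_s m_s = Σ ν_s a_s b_s = |Cov(L,R)|` and the conclusion is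
  (V) `Var(L)² ≤ 2 E[L] |Cov(L,R)|`; with `E = Σ ℓ p q` it is the stronger (V-F).)
* `tree_layerCake_step_small`, `tree_layerCake_step_big` — the induction step of the THEOREM "(LC-F) holds on every tree" (memo part b §3):
  with `X_e = Z_e A_e`-type root data, subtree sums `X_<, X^m_<, Y_<`, the identities `m̂_e ≤ m ⟺ X_e ≤ m Z_e − q X_<` and `Y_e = Z_e − q Y_<`,
  and the hypothesis `X^m_< ≤ m Y_<`, one gets `X_e + X^m_< ≤ m (Y_e + Y_<)` (small root piece) resp. `X^m_< ≤ m (Y_e + Y_<)` (big root piece).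
* `kappa3_mixture_step` — the third central moment of a two-point mixture (weights `p, 1−p`) of laws with raw moments `(e₁,e₂,e₃)`, `(f₁,f₂,f₃)`:
  `κ₃ = p κ₃¹ + q κ₃⁰ + 3 p q (e₁ − f₁)(v¹ − v⁰) + p q (q − p)(e₁ − f₁)³` (`vⁱ` the variances).  Iterated down the exploration tree this is the exact
  formula `κ₃(L) = Σ_s ν_s [(q_s − p_s) a_s³ + 3 a_s (V¹_s − V⁰_s)]` of memo part b §1, which with `V¹_s − V⁰_s = Var(D_s) + 2 Cov_s(L₀, D_s)` and the
  BHK sign `Cov_s(L₀,D_s) ≤ 0` re-proves (P) `κ₃(L) + 3 Cov(L,R) ≤ 0` (`APL.kappa3_add_three_cov_nonpos`) with the explicit slack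
  `2 Σ ν (1+p) a³ + 6 Σ ν a |Cov_s|`.
-/

noncomputable section

namespace Summit.CriticalPhenomena.PercolationContinuityZ3.Theorems

namespace APL

open Finset
open scoped BigOperators

/-! ### (LC) ⟹ (V): the telescoping lemma -/

/-- **Layer-cake telescoping.**  If `x ≥ 0` on a finite set `s` and, for every `i ∈ s`, the `x`-mass of the indices `j` with `m_j ≤ m_i` is at
most `m_i · E`, then `(Σ_i x_i)² ≤ 2 E Σ_i x_i m_i`.  Proof: split `(Σx)² = Σ_{i,j} x_i x_j` according to `m_j ≤ m_i` or `m_i < m_j` and use the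
hypothesis at `i` resp. at `j`. [this work] -/
theorem layerCake_sq_le {ι : Type*} (s : Finset ι) (x m : ι → ℝ) (E : ℝ) (hx : ∀ i ∈ s, 0 ≤ x i)
    (hLC : ∀ i ∈ s, ∑ j ∈ s.filter (fun j => m j ≤ m i), x j ≤ m i * E) :
    (∑ i ∈ s, x i) ^ 2 ≤ 2 * E * ∑ i ∈ s, x i * m i := by
  classical
  -- expand the square
  have hsq : (∑ i ∈ s, x i) ^ 2 = ∑ i ∈ s, ∑ j ∈ s, x i * x j := by
    rw [sq, Finset.sum_mul_sum]
  -- split each inner sum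
  have hsplit : ∀ i ∈ s, ∑ j ∈ s, x i * x j =
      x i * ∑ j ∈ s, (if m j ≤ m i then x j else 0) + x i * ∑ j ∈ s, (if m j ≤ m i then 0 else x j) := by
    intro i _
    rw [Finset.mul_sum, Finset.mul_sum, ← Finset.sum_add_distrib]
    refine Finset.sum_congr rfl fun j _ => ?_
    split_ifs <;> ring
  -- part A: the `m_j ≤ m_i` block, bounded at `i`
  have hA : ∑ i ∈ s, x i * ∑ j ∈ s, (if m j ≤ m i then x j else 0) ≤ ∑ i ∈ s, x i * (m i * E) := by
    refine Finset.sum_le_sum fun i hi => ?_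
    refine mul_le_mul_of_nonneg_left ?_ (hx i hi)
    rw [← Finset.sum_filter]
    exact hLC i hi
  -- part B: the `m_i < m_j` block, swap the sums and bound at `j`
  have hB : ∑ i ∈ s, x i * ∑ j ∈ s, (if m j ≤ m i then 0 else x j) ≤ ∑ j ∈ s, x j * (m j * E) := by
    have hswap : ∑ i ∈ s, x i * ∑ j ∈ s, (if m j ≤ m i then 0 else x j) =
        ∑ j ∈ s, x j * ∑ i ∈ s, (if m j ≤ m i then 0 else x i) := by
      simp_rw [Finset.mul_sum]
      rw [Finset.sum_comm]
      refine Finset.sum_congr rfl fun j _ => Finset.sum_congr rfl fun i _ => ?_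
      split_ifs <;> ring
    rw [hswap]
    refine Finset.sum_le_sum fun j hj => ?_
    refine mul_le_mul_of_nonneg_left ?_ (hx j hj)
    calc ∑ i ∈ s, (if m j ≤ m i then 0 else x i)
        ≤ ∑ i ∈ s, (if m i ≤ m j then x i else 0) := by
          refine Finset.sum_le_sum fun i hi => ?_
          by_cases h1 : m j ≤ m i
          · simp only [h1, if_true]
            split_ifs
            · exact hx i hi
            · exact le_refl 0
          · have h2 : m i ≤ m j := le_of_lt (lt_of_not_ge h1)
            simp only [h1, if_false, h2, if_true, le_refl]
      _ = ∑ i ∈ s.filter (fun i => m i ≤ m j), x i := by rw [Finset.sum_filter]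
      _ ≤ m j * E := hLC j hj
  -- assemble
  have htot : ∑ i ∈ s, ∑ j ∈ s, x i * x j ≤ ∑ i ∈ s, x i * (m i * E) + ∑ j ∈ s, x j * (m j * E) := by
    rw [Finset.sum_congr rfl hsplit, Finset.sum_add_distrib]
    exact add_le_add hA hB
  have hre : ∑ i ∈ s, x i * (m i * E) = E * ∑ i ∈ s, x i * m i := by
    rw [Finset.mul_sum]
    refine Finset.sum_congr rfl fun i _ => ?_
    ring
  rw [hsq]
  linarith [htot, hre]

/-! ### The tree induction step for (LC-F) -/

/-- **Tree step, small root piece.**  Root edge data `X_e, Z` (`X_e = ν A²`, `Z = ν A`), `q = 1 − p`, subtree sums `X_<` (all edges below),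
`X^m_<` (those with `m̂ ≤ m`, so `X^m_< ≤ X_<`), `Y_<`; tree identities give `m̂_e ≤ m ⟺ X_e ≤ m Z − q X_<` and `Y_e = Z − q Y_<`.
If the subtree satisfies (LC-F) at `m` (`X^m_< ≤ m Y_<`) and the root piece is small, then `X_e + X^m_< ≤ m (Y_e + Y_<)`. [this work] -/
theorem tree_layerCake_step_small (m p Z Xe Xlt Xltm Ylt : ℝ) (hp0 : 0 ≤ p) (hp1 : p ≤ 1)
    (hXm : Xltm ≤ Xlt) (hyp : Xltm ≤ m * Ylt)
    (hsmall : Xe ≤ m * Z - (1 - p) * Xlt) :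
    Xe + Xltm ≤ m * ((Z - (1 - p) * Ylt) + Ylt) := by
  have h1 : p * Xltm ≤ p * (m * Ylt) := mul_le_mul_of_nonneg_left hyp hp0
  have h2 : (1 - p) * Xltm ≤ (1 - p) * Xlt := mul_le_mul_of_nonneg_left hXm (by linarith)
  linarith [h1, h2, hsmall]

/-- **Tree step, big root piece.**  With the same data, if the root piece is big (`m̂_e > m`, so the root contributes nothing to the left side)
and `Y_e = Z − q Y_< ≥ 0`, then `X^m_< ≤ m (Y_e + Y_<)`. [this work] -/
theorem tree_layerCake_step_big (m p Z Xltm Ylt : ℝ) (hm : 0 ≤ m)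
    (hyp : Xltm ≤ m * Ylt) (hY : 0 ≤ Z - (1 - p) * Ylt) :
    Xltm ≤ m * ((Z - (1 - p) * Ylt) + Ylt) := by
  have h1 : 0 ≤ m * (Z - (1 - p) * Ylt) := mul_nonneg hm hY
  nlinarith [h1, hyp]

/-! ### The two-point mixture recursion for the third central moment -/

/-- **`κ₃` of a two-point mixture.**  For weights `p`, `q = 1 − p` and raw moments `(e₁,e₂,e₃)`, `(f₁,f₂,f₃)` of two laws, the mixture has raw
moments `g_k = p e_k + q f_k`, and its third central moment `g₃ − 3g₁g₂ + 2g₁³` equals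
`p κ¹ + q κ⁰ + 3pq (e₁ − f₁)((e₂ − e₁²) − (f₂ − f₁²)) + pq(q − p)(e₁ − f₁)³` (`κⁱ` the central third moments of the two laws).
Applied at every state of the cluster exploration (`e₁ − f₁ = a_s`) this is the exact formula for `κ₃(L)` of memo part b §1. [this work] -/
theorem kappa3_mixture_step (p e₁ e₂ e₃ f₁ f₂ f₃ : ℝ) :
    (p * e₃ + (1 - p) * f₃) - 3 * (p * e₁ + (1 - p) * f₁) * (p * e₂ + (1 - p) * f₂) + 2 * (p * e₁ + (1 - p) * f₁) ^ 3 =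
      p * (e₃ - 3 * e₁ * e₂ + 2 * e₁ ^ 3) + (1 - p) * (f₃ - 3 * f₁ * f₂ + 2 * f₁ ^ 3)
        + 3 * p * (1 - p) * (e₁ - f₁) * ((e₂ - e₁ ^ 2) - (f₂ - f₁ ^ 2))
        + p * (1 - p) * ((1 - p) - p) * (e₁ - f₁) ^ 3 := by
  ring

end APL

end Summit.CriticalPhenomena.PercolationContinuityZ3.Theorems
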